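import Mathlib.Analysis.SpecialFunctions.Integrals.Basic
import Mathlib.Analysis.Calculus.MeanValue
import Mathlib.Analysis.SpecialFunctions.Trigonometric.Bounds
import Mathlib.MeasureTheory.Integral.IntervalIntegral.IntegrationByParts
import HarnessLib

/-!
# The angular Hardy inequality of Elgindi ([Elgindi2021] Lemma 7.2)

Topic `Literature/Analysis/FluidPDE`. Proof file (everything proved, no definitions, no named
facts) on the proof path of the named fact
`Literature.Analysis.FluidPDE.Elgindi.ElgindiGhoulMasmoudi2021_stabilityCore`
(`ElgindiStabilityDecomposition.lean`). T. M. Elgindi, Ann. of Math. 194 (2021) =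
arXiv:1904.04795, §7.2 "Hardy Inequalities" (p. 20 of the held text):

> "**Lemma 7.2.** Let `f ∈ H¹([0,π/2])`. Assume that `f(0) = f(π/2) = 0`. Then,
> `∫₀^{π/2} |f(θ)|²/sin²(2θ) dθ ≤ 10∫₀^{π/2}|f'(θ)|² dθ`.
> The proof of this lemma follows from the original Hardy inequality by noting that
> `sin(2θ) ≥ 1 − (4/π)|θ − π/4|` for `θ ∈ [0,π/2]`, splitting the integral into two pieces, and making
> a change of variables."

Exactly this, for `f ∈ C¹(ℝ)` (the case used downstream; the `H¹` statement follows by density):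
the one-sided Hardy inequalities `∫ₐᵇ f²/(x−a)² ≤ 4∫ₐᵇ f'²` (`f(a) = 0`) and `∫ₐᵇ f²/(b−x)² ≤ 4∫ₐᵇ f'²`
(`f(b) = 0`), proved without limits through the pointwise identity
`½f²/x² ≤ 2f'² − (f²/x)'` on `[ε, b]` and `|f(x)| ≤ Mx`, and then Jordan's inequality
`sin(2θ) ≥ (4/π)min(θ, π/2 − θ)` on the two halves of `[0, π/2]` (constant `π²/4·… ≤ 10`).
-/

noncomputable section

open MeasureTheory Set Real Filter intervalIntegral
open _root_.Topology

namespace Literature.Analysis.FluidPDE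

namespace Elgindi

/-! ### A Lipschitz bound from the origin -/

/-- For `f ∈ C¹` with `f(0) = 0`: `|f(x)| ≤ M·|x|` for `|x| ≤ R`, with `M ≥ 0` a bound of `|f'|` on `[-R, R]`. [folklore] -/
theorem exists_abs_le_mul_of_deriv {f : ℝ → ℝ} (hf : ContDiff ℝ 1 f) (h0 : f 0 = 0) (R : ℝ) :
    ∃ M, 0 ≤ M ∧ ∀ x : ℝ, |x| ≤ R → |f x| ≤ M * |x| := by
  have hd : Differentiable ℝ f := hf.differentiable (by simp)
  have hc : Continuous (deriv f) := hf.continuous_deriv le_rfl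
  obtain ⟨M, hM⟩ := isCompact_Icc.exists_bound_of_continuousOn (s := Icc (-R) R) hc.continuousOn
  refine ⟨max M 0, le_max_right _ _, fun x hx => ?_⟩
  have hxR : x ∈ Icc (-R) R := ⟨by linarith [neg_abs_le x], (le_abs_self x).trans hx⟩
  have hseg : ∀ y ∈ Set.uIcc 0 x, ‖deriv f y‖ ≤ max M 0 := by
    intro y hy
    refine (hM y ⟨?_, ?_⟩).trans (le_max_left _ _)
    · rcases Set.mem_uIcc.1 hy with h | h
      · linarith [hxR.1, h.1, abs_nonneg x]
      · linarith [hxR.1, h.1]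
    · rcases Set.mem_uIcc.1 hy with h | h
      · linarith [hxR.2, h.2]
      · linarith [hxR.2, h.2, abs_nonneg x]
  have h := Convex.norm_image_sub_le_of_norm_deriv_le (fun y _ => hd.differentiableAt) hseg (convex_uIcc 0 x)
    (left_mem_uIcc) (right_mem_uIcc)
  simpa [h0, Real.norm_eq_abs] using h

/-! ### The one-sided Hardy inequality at the origin -/

/-- **Hardy's inequality on `[0, b]` for `f ∈ C¹` with `f(0) = 0`**: `∫₀ᵇ f²/x² ≤ 4∫₀ᵇ f'²`. [cite: Elgindi2021, §7.2 Lemma 7.2 ("the original Hardy inequality") (p. 20 of arXiv:1904.04795)] -/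
theorem hardy_origin {f : ℝ → ℝ} (hf : ContDiff ℝ 1 f) (h0 : f 0 = 0) {b : ℝ} (hb : 0 ≤ b) :
    ∫ x in (0 : ℝ)..b, f x ^ 2 / x ^ 2 ≤ 4 * ∫ x in (0 : ℝ)..b, deriv f x ^ 2 := by
  have hd : Differentiable ℝ f := hf.differentiable (by simp)
  have hfc : Continuous f := hf.continuous
  have hdc : Continuous (deriv f) := hf.continuous_deriv le_rfl
  obtain ⟨M, hM0, hM⟩ := exists_abs_le_mul_of_deriv hf h0 b
  -- the integrand is bounded by `M²` on `[0, b]`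
  have hbound : ∀ x ∈ Icc 0 b, f x ^ 2 / x ^ 2 ≤ M ^ 2 := by
    intro x hx
    rcases eq_or_lt_of_le hx.1 with h | h
    · rw [← h]; simp; positivity
    · have h1 := hM x (by rw [abs_of_pos h]; exact hx.2)
      rw [abs_of_pos h] at h1
      rw [div_le_iff₀ (by positivity), ← sq_abs]
      calc |f x| ^ 2 ≤ (M * x) ^ 2 := pow_le_pow_left₀ (abs_nonneg _) h1 2
        _ = M ^ 2 * x ^ 2 := by ring
  -- integrability of `f²/x²` on subintervals of `[0, b]`
  have hmeas : Measurable fun x : ℝ => f x ^ 2 / x ^ 2 := (hfc.measurable.pow_const 2).div (measurable_id.pow_const 2)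
  have hint : ∀ c d, 0 ≤ c → c ≤ d → d ≤ b → IntervalIntegrable (fun x => f x ^ 2 / x ^ 2) volume c d := by
    intro c d hc hcd hdb
    refine IntervalIntegrable.mono_fun' (g := fun _ => M ^ 2) intervalIntegrable_const hmeas.aestronglyMeasurable ?_
    rw [EventuallyLE, ae_restrict_iff' measurableSet_uIoc]
    refine Filter.Eventually.of_forall fun x hx => ?_
    rw [Set.uIoc_of_le hcd] at hx
    rw [Real.norm_eq_abs, abs_of_nonneg (by positivity)]
    exact hbound x ⟨hc.trans hx.1.le, hx.2.trans hdb⟩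
  have iD : ∀ c d : ℝ, IntervalIntegrable (fun x => deriv f x ^ 2) volume c d := fun c d =>
    (hdc.pow 2).intervalIntegrable c d
  -- the key estimate on `[ε, b]` for `0 < ε ≤ b`
  have hkey : ∀ ε, 0 < ε → ε ≤ b →
      ∫ x in ε..b, f x ^ 2 / x ^ 2 ≤ 4 * (∫ x in ε..b, deriv f x ^ 2) + 2 * (M ^ 2 * ε) := by
    intro ε hε hεb
    set h : ℝ → ℝ := fun x => f x ^ 2 / x with hh
    have hder : ∀ x ∈ Set.uIcc ε b, HasDerivAt h (2 * f x * deriv f x / x - f x ^ 2 / x ^ 2) x := by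
      intro x hx
      rw [Set.uIcc_of_le hεb] at hx
      have hx0 : x ≠ 0 := by linarith [hx.1]
      have e2 : (fun y => f y ^ 2) = fun y => f y * f y := by funext y; ring
      have h1 : HasDerivAt (fun y => f y ^ 2) (2 * f x * deriv f x) x := by
        rw [e2]
        exact ((hd x).hasDerivAt.mul (hd x).hasDerivAt).congr_deriv (by ring)
      have h2 := h1.fun_div (hasDerivAt_id' x) hx0
      refine h2.congr_deriv ?_
      field_simp
    have hcont' : ContinuousOn (fun x => 2 * f x * deriv f x / x - f x ^ 2 / x ^ 2) (Set.uIcc ε b) := by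
      rw [Set.uIcc_of_le hεb]
      refine ContinuousOn.sub ?_ ?_
      · exact ContinuousOn.div (by fun_prop) continuousOn_id fun x hx => by linarith [hx.1]
      · exact ContinuousOn.div (by fun_prop) (continuousOn_id.pow 2) fun x hx => by
          have : 0 < x := by linarith [hx.1]
          positivity
    have hFTC := integral_eq_sub_of_hasDerivAt hder (hcont'.intervalIntegrable)
    -- pointwise: `½ f²/x² ≤ 2 f'² − h'`
    have hpt : ∀ x ∈ Icc ε b, (1 / 2) * (f x ^ 2 / x ^ 2) ≤
        2 * deriv f x ^ 2 - (2 * f x * deriv f x / x - f x ^ 2 / x ^ 2) := by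
      intro x hx
      have hx0 : 0 < x := by linarith [hx.1]
      have h2ab : 2 * f x * deriv f x / x ≤ (1 / 2) * (f x ^ 2 / x ^ 2) + 2 * deriv f x ^ 2 := by
        have : 2 * f x * deriv f x / x = 2 * (f x / x) * deriv f x := by field_simp
        rw [this]
        have e : f x ^ 2 / x ^ 2 = (f x / x) ^ 2 := by rw [div_pow]
        rw [e]
        nlinarith [sq_nonneg (f x / x - 2 * deriv f x)]
      linarith
    have i1 : IntervalIntegrable (fun x => (1 / 2) * (f x ^ 2 / x ^ 2)) volume ε b := (hint ε b hε.le hεb le_rfl).const_mul _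
    have iD2 : IntervalIntegrable (fun x => 2 * deriv f x ^ 2) volume ε b := (iD ε b).const_mul 2
    have iH : IntervalIntegrable (fun x => 2 * f x * deriv f x / x - f x ^ 2 / x ^ 2) volume ε b := hcont'.intervalIntegrable
    have i2 : IntervalIntegrable (fun x => 2 * deriv f x ^ 2 - (2 * f x * deriv f x / x - f x ^ 2 / x ^ 2)) volume ε b :=
      iD2.sub iH
    have hmono := intervalIntegral.integral_mono_on hεb i1 i2 fun x hx => hpt x hx
    rw [intervalIntegral.integral_const_mul, intervalIntegral.integral_sub iD2 iH, intervalIntegral.integral_const_mul, hFTC] at hmono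
    -- the boundary terms: `h b ≥ 0`, `h ε ≤ M² ε`
    have hhb : 0 ≤ h b := by simp only [hh]; exact div_nonneg (sq_nonneg _) (hε.le.trans hεb)
    have hhε : h ε ≤ M ^ 2 * ε := by
      simp only [hh]
      have h1 := hM ε (by rw [abs_of_pos hε]; exact hεb)
      rw [abs_of_pos hε] at h1
      rw [div_le_iff₀ hε, ← sq_abs]
      calc |f ε| ^ 2 ≤ (M * ε) ^ 2 := pow_le_pow_left₀ (abs_nonneg _) h1 2
        _ = M ^ 2 * ε * ε := by ring
    linarith
  -- conclude: for every `0 < ε ≤ b`, `∫₀ᵇ = ∫₀^ε + ∫_ε^b ≤ M²ε + 4∫_ε^b f'² + 2M²ε ≤ 4∫₀ᵇ f'² + 3M²ε`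
  rcases eq_or_lt_of_le hb with hb0 | hbpos
  · rw [← hb0]; simp
  refine le_of_forall_pos_le_add fun δ hδ => ?_
  obtain ⟨ε, hε, hεb, hεδ⟩ : ∃ ε, 0 < ε ∧ ε ≤ b ∧ 3 * (M ^ 2 * ε) ≤ δ := by
    refine ⟨min b (δ / (3 * (M ^ 2 + 1))), lt_min hbpos (by positivity), min_le_left _ _, ?_⟩
    have h1 : min b (δ / (3 * (M ^ 2 + 1))) ≤ δ / (3 * (M ^ 2 + 1)) := min_le_right _ _
    have h2 : 3 * (M ^ 2 * (δ / (3 * (M ^ 2 + 1)))) ≤ δ := by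
      rw [show 3 * (M ^ 2 * (δ / (3 * (M ^ 2 + 1)))) = δ * (M ^ 2 / (M ^ 2 + 1)) by field_simp]
      have : M ^ 2 / (M ^ 2 + 1) ≤ 1 := by rw [div_le_one (by positivity)]; linarith
      nlinarith
    nlinarith [mul_le_mul_of_nonneg_left h1 (by positivity : (0 : ℝ) ≤ 3 * M ^ 2)]
  have hsplit : ∫ x in (0 : ℝ)..b, f x ^ 2 / x ^ 2 = (∫ x in (0 : ℝ)..ε, f x ^ 2 / x ^ 2) + ∫ x in ε..b, f x ^ 2 / x ^ 2 :=
    (integral_add_adjacent_intervals (hint 0 ε le_rfl hε.le hεb) (hint ε b hε.le hεb le_rfl)).symm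
  have h0ε : ∫ x in (0 : ℝ)..ε, f x ^ 2 / x ^ 2 ≤ M ^ 2 * ε := by
    have := intervalIntegral.integral_mono_on hε.le (hint 0 ε le_rfl hε.le hεb) intervalIntegrable_const
      fun x hx => hbound x ⟨hx.1, hx.2.trans hεb⟩
    rw [intervalIntegral.integral_const, smul_eq_mul, sub_zero] at this
    linarith
  have hsub : ∫ x in ε..b, deriv f x ^ 2 ≤ ∫ x in (0 : ℝ)..b, deriv f x ^ 2 := by
    rw [← integral_add_adjacent_intervals (iD 0 ε) (iD ε b)]
    have : 0 ≤ ∫ x in (0 : ℝ)..ε, deriv f x ^ 2 := intervalIntegral.integral_nonneg hε.le fun x _ => sq_nonneg _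
    linarith
  have hk := hkey ε hε hεb
  rw [hsplit]
  linarith

/-! ### Translated and reflected versions -/

/-- Hardy from the left endpoint: `f(a) = 0` gives `∫ₐᵇ f²/(x−a)² ≤ 4∫ₐᵇ f'²`. [folklore] -/
theorem hardy_left {f : ℝ → ℝ} (hf : ContDiff ℝ 1 f) {a b : ℝ} (hab : a ≤ b) (h0 : f a = 0) :
    ∫ x in a..b, f x ^ 2 / (x - a) ^ 2 ≤ 4 * ∫ x in a..b, deriv f x ^ 2 := by
  set g : ℝ → ℝ := fun y => f (y + a) with hg
  have hgc : ContDiff ℝ 1 g := hf.comp (contDiff_id.add contDiff_const)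
  have hg0 : g 0 = 0 := by simp [hg, h0]
  have hgd : ∀ y, deriv g y = deriv f (y + a) := by
    intro y
    simp only [hg]
    rw [deriv_comp_add_const]
  have h := hardy_origin hgc hg0 (b := b - a) (by linarith)
  have e1 : ∫ x in a..b, f x ^ 2 / (x - a) ^ 2 = ∫ y in (0 : ℝ)..(b - a), g y ^ 2 / y ^ 2 := by
    rw [hg]
    have := intervalIntegral.integral_comp_add_right (fun x => f x ^ 2 / (x - a) ^ 2) a (a := 0) (b := b - a)
    simp only [zero_add, sub_add_cancel, add_sub_cancel_right] at this
    rw [← this]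
  have e2 : ∫ x in a..b, deriv f x ^ 2 = ∫ y in (0 : ℝ)..(b - a), deriv g y ^ 2 := by
    simp only [hgd]
    have := intervalIntegral.integral_comp_add_right (fun x => deriv f x ^ 2) a (a := 0) (b := b - a)
    simp only [zero_add, sub_add_cancel] at this
    rw [← this]
  rw [e1, e2]
  exact h

/-- Hardy from the right endpoint: `f(b) = 0` gives `∫ₐᵇ f²/(b−x)² ≤ 4∫ₐᵇ f'²`. [folklore] -/
theorem hardy_right {f : ℝ → ℝ} (hf : ContDiff ℝ 1 f) {a b : ℝ} (hab : a ≤ b) (h0 : f b = 0) :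
    ∫ x in a..b, f x ^ 2 / (b - x) ^ 2 ≤ 4 * ∫ x in a..b, deriv f x ^ 2 := by
  set g : ℝ → ℝ := fun y => f (-y) with hg
  have hgc : ContDiff ℝ 1 g := hf.comp contDiff_neg
  have hg0 : g (-b) = 0 := by simp [hg, h0]
  have hgd : ∀ y, deriv g y = -deriv f (-y) := by
    intro y
    simp only [hg]
    rw [deriv_comp_neg]
  have h := hardy_left hgc (a := -b) (b := -a) (by linarith) hg0
  have e1 : ∫ x in a..b, f x ^ 2 / (b - x) ^ 2 = ∫ y in (-b)..(-a), g y ^ 2 / (y - -b) ^ 2 := by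
    rw [hg]
    have := intervalIntegral.integral_comp_neg (fun x => f x ^ 2 / (b - x) ^ 2) (a := -b) (b := -a)
    simp only [neg_neg] at this
    rw [← this]
    refine intervalIntegral.integral_congr fun y _ => ?_
    simp only
    ring_nf
  have e2 : ∫ x in a..b, deriv f x ^ 2 = ∫ y in (-b)..(-a), deriv g y ^ 2 := by
    simp only [hgd, neg_sq]
    have := intervalIntegral.integral_comp_neg (fun x => deriv f x ^ 2) (a := -b) (b := -a)
    simp only [neg_neg] at this
    rw [← this]
  rw [e1, e2]
  exact h

/-! ### Jordan on both halves of the quarter -/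

/-- `sin(2θ) ≥ (4/π)θ` for `θ ∈ [0, π/4]`. [folklore] -/
theorem four_div_pi_mul_le_sin_two_mul {θ : ℝ} (h0 : 0 ≤ θ) (h1 : θ ≤ π / 4) : 4 / π * θ ≤ Real.sin (2 * θ) := by
  have h := Real.mul_le_sin (x := 2 * θ) (by linarith) (by linarith)
  convert h using 1
  ring

/-- `sin(2θ) ≥ (4/π)(π/2 − θ)` for `θ ∈ [π/4, π/2]`. [folklore] -/
theorem four_div_pi_mul_sub_le_sin_two_mul {θ : ℝ} (h0 : π / 4 ≤ θ) (h1 : θ ≤ π / 2) :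
    4 / π * (π / 2 - θ) ≤ Real.sin (2 * θ) := by
  have h := Real.mul_le_sin (x := π - 2 * θ) (by linarith) (by linarith)
  rw [Real.sin_pi_sub] at h
  convert h using 1
  ring

/-! ### Lemma 7.2 -/

/-- **The angular Hardy inequality** (Elgindi 2021, Lemma 7.2: "Let `f ∈ H¹([0,π/2])`. Assume that
`f(0) = f(π/2) = 0`. Then, `∫₀^{π/2}|f(θ)|²/sin²(2θ)dθ ≤ 10∫₀^{π/2}|f'(θ)|²dθ`"), for `f ∈ C¹(ℝ)`. [cite: Elgindi2021, §7.2 Lemma 7.2 (p. 20 of arXiv:1904.04795)] -/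
theorem angularHardy {f : ℝ → ℝ} (hf : ContDiff ℝ 1 f) (h0 : f 0 = 0) (h1 : f (π / 2) = 0) :
    ∫ θ in (0 : ℝ)..(π / 2), f θ ^ 2 / Real.sin (2 * θ) ^ 2 ≤ 10 * ∫ θ in (0 : ℝ)..(π / 2), deriv f θ ^ 2 := by
  have hfc : Continuous f := hf.continuous
  have hdc : Continuous (deriv f) := hf.continuous_deriv le_rfl
  have hπ4 : (0 : ℝ) < π / 4 := by positivity
  -- the two Hardy bounds
  have hL := hardy_left hf (a := 0) (b := π / 4) hπ4.le h0
  have hR := hardy_right hf (a := π / 4) (b := π / 2) (by linarith [Real.pi_pos]) h1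
  simp only [sub_zero] at hL
  -- integrability of the singular integrand on each half, by comparison with the Hardy integrands
  obtain ⟨M, hM0, hM⟩ := exists_abs_le_mul_of_deriv hf h0 (π / 2)
  set g : ℝ → ℝ := fun y => f (π / 2 - y) with hg
  have hgc' : ContDiff ℝ 1 g := hf.comp (contDiff_const.sub contDiff_id)
  have hg0 : g 0 = 0 := by simp [hg, h1]
  obtain ⟨M', hM'0, hM'⟩ := exists_abs_le_mul_of_deriv hgc' hg0 (π / 2)
  have hmeas : Measurable fun θ : ℝ => f θ ^ 2 / Real.sin (2 * θ) ^ 2 :=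
    (hfc.measurable.pow_const 2).div ((Real.continuous_sin.comp (continuous_const.mul continuous_id)).measurable.pow_const 2)
  -- pointwise bounds on the two halves
  have hb1 : ∀ θ ∈ Icc (0 : ℝ) (π / 4), f θ ^ 2 / Real.sin (2 * θ) ^ 2 ≤ (π / 4) ^ 2 * (f θ ^ 2 / θ ^ 2) := by
    intro θ hθ
    rcases eq_or_lt_of_le hθ.1 with h | h
    · rw [← h]; simp [h0]
    · have hj := four_div_pi_mul_le_sin_two_mul hθ.1 hθ.2
      have hs : 0 < Real.sin (2 * θ) := lt_of_lt_of_le (by positivity) hj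
      rw [div_le_iff₀ (by positivity)]
      have e : (π / 4) ^ 2 * (f θ ^ 2 / θ ^ 2) * Real.sin (2 * θ) ^ 2 = f θ ^ 2 * (π / 4 * Real.sin (2 * θ) / θ) ^ 2 := by
        field_simp
      rw [e]
      have h1' : 1 ≤ π / 4 * Real.sin (2 * θ) / θ := by
        rw [le_div_iff₀ h]
        have := mul_le_mul_of_nonneg_left hj (by positivity : (0 : ℝ) ≤ π / 4)
        calc 1 * θ = π / 4 * (4 / π * θ) := by field_simp
          _ ≤ π / 4 * Real.sin (2 * θ) := this
      calc f θ ^ 2 = f θ ^ 2 * 1 ^ 2 := by ring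
        _ ≤ f θ ^ 2 * (π / 4 * Real.sin (2 * θ) / θ) ^ 2 := by
            exact mul_le_mul_of_nonneg_left (pow_le_pow_left₀ zero_le_one h1' 2) (sq_nonneg _)
  have hb2 : ∀ θ ∈ Icc (π / 4) (π / 2), f θ ^ 2 / Real.sin (2 * θ) ^ 2 ≤ (π / 4) ^ 2 * (f θ ^ 2 / (π / 2 - θ) ^ 2) := by
    intro θ hθ
    rcases eq_or_lt_of_le hθ.2 with h | h
    · rw [h]; simp [h1]
    · have hpos : 0 < π / 2 - θ := by linarith
      have hj := four_div_pi_mul_sub_le_sin_two_mul hθ.1 hθ.2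
      have hs : 0 < Real.sin (2 * θ) := lt_of_lt_of_le (by positivity) hj
      rw [div_le_iff₀ (by positivity)]
      have e : (π / 4) ^ 2 * (f θ ^ 2 / (π / 2 - θ) ^ 2) * Real.sin (2 * θ) ^ 2 =
          f θ ^ 2 * (π / 4 * Real.sin (2 * θ) / (π / 2 - θ)) ^ 2 := by
        field_simp
      rw [e]
      have h1' : 1 ≤ π / 4 * Real.sin (2 * θ) / (π / 2 - θ) := by
        rw [le_div_iff₀ hpos]
        have := mul_le_mul_of_nonneg_left hj (by positivity : (0 : ℝ) ≤ π / 4)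
        calc 1 * (π / 2 - θ) = π / 4 * (4 / π * (π / 2 - θ)) := by field_simp
          _ ≤ π / 4 * Real.sin (2 * θ) := this
      calc f θ ^ 2 = f θ ^ 2 * 1 ^ 2 := by ring
        _ ≤ f θ ^ 2 * (π / 4 * Real.sin (2 * θ) / (π / 2 - θ)) ^ 2 := by
            exact mul_le_mul_of_nonneg_left (pow_le_pow_left₀ zero_le_one h1' 2) (sq_nonneg _)
  -- the Hardy integrands are bounded, hence integrable
  have hbd1 : ∀ θ ∈ Icc (0 : ℝ) (π / 4), f θ ^ 2 / θ ^ 2 ≤ M ^ 2 := by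
    intro θ hθ
    rcases eq_or_lt_of_le hθ.1 with h | h
    · rw [← h]; simp; positivity
    · have := hM θ (by rw [abs_of_pos h]; linarith [hθ.2, Real.pi_pos])
      rw [abs_of_pos h] at this
      rw [div_le_iff₀ (by positivity), ← sq_abs]
      calc |f θ| ^ 2 ≤ (M * θ) ^ 2 := pow_le_pow_left₀ (abs_nonneg _) this 2
        _ = M ^ 2 * θ ^ 2 := by ring
  have hbd2 : ∀ θ ∈ Icc (π / 4) (π / 2), f θ ^ 2 / (π / 2 - θ) ^ 2 ≤ M' ^ 2 := by
    intro θ hθ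
    rcases eq_or_lt_of_le hθ.2 with h | h
    · rw [h]; simp; positivity
    · have hpos : 0 < π / 2 - θ := by linarith
      have := hM' (π / 2 - θ) (by rw [abs_of_pos hpos]; linarith [hθ.1, Real.pi_pos])
      simp only [hg, sub_sub_cancel, abs_of_pos hpos] at this
      rw [div_le_iff₀ (by positivity), ← sq_abs]
      calc |f θ| ^ 2 ≤ (M' * (π / 2 - θ)) ^ 2 := pow_le_pow_left₀ (abs_nonneg _) this 2
        _ = M' ^ 2 * (π / 2 - θ) ^ 2 := by ring
  have hI1 : IntervalIntegrable (fun θ => f θ ^ 2 / Real.sin (2 * θ) ^ 2) volume 0 (π / 4) := by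
    refine IntervalIntegrable.mono_fun' (g := fun _ => (π / 4) ^ 2 * M ^ 2) intervalIntegrable_const
      hmeas.aestronglyMeasurable ?_
    rw [EventuallyLE, ae_restrict_iff' measurableSet_uIoc]
    refine Filter.Eventually.of_forall fun θ hθ => ?_
    rw [Set.uIoc_of_le hπ4.le] at hθ
    rw [Real.norm_eq_abs, abs_of_nonneg (by positivity)]
    exact (hb1 θ ⟨hθ.1.le, hθ.2⟩).trans (mul_le_mul_of_nonneg_left (hbd1 θ ⟨hθ.1.le, hθ.2⟩) (by positivity))
  have hI2 : IntervalIntegrable (fun θ => f θ ^ 2 / Real.sin (2 * θ) ^ 2) volume (π / 4) (π / 2) := by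
    refine IntervalIntegrable.mono_fun' (g := fun _ => (π / 4) ^ 2 * M' ^ 2) intervalIntegrable_const
      hmeas.aestronglyMeasurable ?_
    rw [EventuallyLE, ae_restrict_iff' measurableSet_uIoc]
    refine Filter.Eventually.of_forall fun θ hθ => ?_
    rw [Set.uIoc_of_le (by linarith)] at hθ
    rw [Real.norm_eq_abs, abs_of_nonneg (by positivity)]
    exact (hb2 θ ⟨hθ.1.le, hθ.2⟩).trans (mul_le_mul_of_nonneg_left (hbd2 θ ⟨hθ.1.le, hθ.2⟩) (by positivity))
  have hH1 : IntervalIntegrable (fun θ => (π / 4) ^ 2 * (f θ ^ 2 / θ ^ 2)) volume 0 (π / 4) := by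
    have hm : Measurable fun θ : ℝ => f θ ^ 2 / θ ^ 2 := (hfc.measurable.pow_const 2).div (measurable_id.pow_const 2)
    refine (IntervalIntegrable.mono_fun' (g := fun _ => M ^ 2) intervalIntegrable_const hm.aestronglyMeasurable ?_).const_mul _
    rw [EventuallyLE, ae_restrict_iff' measurableSet_uIoc]
    refine Filter.Eventually.of_forall fun θ hθ => ?_
    rw [Set.uIoc_of_le hπ4.le] at hθ
    rw [Real.norm_eq_abs, abs_of_nonneg (by positivity)]
    exact hbd1 θ ⟨hθ.1.le, hθ.2⟩
  have hH2 : IntervalIntegrable (fun θ => (π / 4) ^ 2 * (f θ ^ 2 / (π / 2 - θ) ^ 2)) volume (π / 4) (π / 2) := by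
    have hm : Measurable fun θ : ℝ => f θ ^ 2 / (π / 2 - θ) ^ 2 :=
      (hfc.measurable.pow_const 2).div ((measurable_const.sub measurable_id).pow_const 2)
    refine (IntervalIntegrable.mono_fun' (g := fun _ => M' ^ 2) intervalIntegrable_const hm.aestronglyMeasurable ?_).const_mul _
    rw [EventuallyLE, ae_restrict_iff' measurableSet_uIoc]
    refine Filter.Eventually.of_forall fun θ hθ => ?_
    rw [Set.uIoc_of_le (by linarith)] at hθ
    rw [Real.norm_eq_abs, abs_of_nonneg (by positivity)]
    exact hbd2 θ ⟨hθ.1.le, hθ.2⟩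
  -- compare and assemble
  have m1 := intervalIntegral.integral_mono_on hπ4.le hI1 hH1 fun θ hθ => hb1 θ hθ
  have m2 := intervalIntegral.integral_mono_on (by linarith : π / 4 ≤ π / 2) hI2 hH2 fun θ hθ => hb2 θ hθ
  rw [intervalIntegral.integral_const_mul] at m1 m2
  have hsplit : ∫ θ in (0 : ℝ)..(π / 2), f θ ^ 2 / Real.sin (2 * θ) ^ 2 =
      (∫ θ in (0 : ℝ)..(π / 4), f θ ^ 2 / Real.sin (2 * θ) ^ 2) + ∫ θ in (π / 4)..(π / 2), f θ ^ 2 / Real.sin (2 * θ) ^ 2 :=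
    (integral_add_adjacent_intervals hI1 hI2).symm
  have iD : ∀ c d : ℝ, IntervalIntegrable (fun x => deriv f x ^ 2) volume c d := fun c d =>
    (hdc.pow 2).intervalIntegrable c d
  have hsplit' : ∫ θ in (0 : ℝ)..(π / 2), deriv f θ ^ 2 =
      (∫ θ in (0 : ℝ)..(π / 4), deriv f θ ^ 2) + ∫ θ in (π / 4)..(π / 2), deriv f θ ^ 2 :=
    (integral_add_adjacent_intervals (iD 0 (π / 4)) (iD (π / 4) (π / 2))).symm
  have hD1 : 0 ≤ ∫ θ in (0 : ℝ)..(π / 4), deriv f θ ^ 2 := intervalIntegral.integral_nonneg hπ4.le fun θ _ => sq_nonneg _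
  have hD2 : 0 ≤ ∫ θ in (π / 4)..(π / 2), deriv f θ ^ 2 :=
    intervalIntegral.integral_nonneg (by linarith) fun θ _ => sq_nonneg _
  have hπ : (π / 4) ^ 2 * 4 ≤ 10 := by nlinarith [Real.pi_le_four, Real.pi_pos]
  rw [hsplit, hsplit']
  nlinarith [m1, m2, hL, hR, hD1, hD2, hπ, Real.pi_pos]

end Elgindi

end Literature.Analysis.FluidPDE
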